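import Summits.BirchSwinnertonDyer.BirchSwinnertonDyer.Theorems.EisensteinPrimesAnalyticLambdaCongruenceTransfer
import HarnessLib

/-!
# Route `EisensteinPrimes`, line `mudescent`, crux 3: the relative analytic λ-count from a COMMON
# SOURCE — two integral models that are unit multiples of specialisations of ONE power series
# along ring maps agreeing mod `p` are congruent mod `p` to every order, hence (via the twin socket)
# transfer `μ_an = 0` and `λ_an` (helper; the algebraic shape of "cuspidal `L`-symbol universality")

Seat `bsd-eis-lam-a` g7 (PROGRAMME PART 1b, ACCEL-LIST (4): ANALYTIC side of
`stub_lambdaCount_offLocus`; items stmt-BirchSwinnertonDyer-19033 / -19035; skeleton owner bsd-eis-ky,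
`Lines/mudescent.lean`; research object (C-λ) = aside stmt-BirchSwinnertonDyer-20112). THEOREMS ONLY —
no definition, no named fact, nothing about any particular curve; closes nothing; moves no label.

WHAT AND WHY. The twin socket `EisensteinPrimesAnalyticLambdaCongruenceTransfer` (lam-a g5) takes a
DISPLAYED truncated congruence `G·P ≡ u·G′·P′ (mod p, T^K)` between the Σ₀-depleted integral models
of two `E[p]`-twins and returns `X2.AnalyticMuLE W p 0 ∧ X2.AnalyticLambdaEq W p n`. The seat's g7
experiments (HOME/lam-a-g7/: JOB «twistu» kit j276790 — the congruence persists under 22 even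
quadratic twists with ONE unit `u` for all of them, 7 638/7 638, 644/644 pairs; FINDING (A) — the
tangent functional of an étale end is the product of its two Kummer characters) single out the shape
in which such a congruence arises on the Hecke side: both depleted models are unit multiples of the
specialisations of ONE element `ℒ ∈ R⟦T⟧` (Pollack–Wake's «cuspidal normalisation» of the
Mazur–Kitagawa `L`-symbol over the localised cuspidal Hecke algebra `R = 𝕋⁰_𝔪`, well defined when
`𝕋⁰_𝔪` is Gorenstein: Pollack–Wake, Tunis. J. Math. 7 (2025) §1.4; at squarefree level the
Gorenstein criterion is Wake–Wang-Erickson, Adv. Math. 380 (2021) Thm. 1.4.1 (2)) along the two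
weight-2 points `θ, θ′ : R → ℤ_p` of the twins, which agree modulo `p` because both reduce to the
Eisenstein character. This file is the algebra of that shape, as a SOCKET one level below g5's:

* §1 (`Λ`-algebra, any commutative `R`): `coeff_map_toZMod_eq_mul_of_commonSource` — if
  `x₁ = C(c₁)·θ₁(ℒ)` and `x₂ = C(c₂)·θ₂(ℒ)` in `Λ = ℤ_p⟦T⟧` with `θ̄₁ = θ̄₂ : R → 𝔽_p` and
  `c₁, c₂ ∈ ℤ_p^×`, then `x̄₁ = u·x̄₂` coefficientwise in `𝔽_p⟦T⟧` with `u = c̄₁c̄₂⁻¹ ≠ 0` (so the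
  truncated congruence of the g5 socket holds for EVERY `K`);
  `hasUnitContent_and_lam_add_eq_of_commonSource` — with multipliers `P₁, P₂` (the Σ₀-Euler
  products; `P₂` of unit content, orders `d₁, d₂`) and `b₂` of unit content:
  `μ(b₁) = 0 ∧ λ(b₁) + d₁ = λ(b₂) + d₂`.
* §2 X2 ← X2: `X2.analyticMuLE_zero_and_analyticLambdaEq_of_commonSource` — the data of
  `EisensteinPrimesAnalyticLambdaCongruenceTransfer.X2.analyticMuLE_zero_and_analyticLambdaEq_of_truncCongr`
  with its `(u, K, hcong, hK)` replaced by the common-source data `(R, θ, θ′, ℒ, c, c′)` ⟹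
  `X2.AnalyticMuLE W p 0 ∧ X2.AnalyticLambdaEq W p n`.

HONEST FRAMING. The existence of `(R, θ, θ′, ℒ, c, c′)` for a given pair of type-A twins is NOT
asserted here and is not a Literature fact: at prime level it is Pollack–Wake 2025 (Thm. 1.2 with
§1.4), at squarefree level it needs the Gorenstein property of `𝕋^{0,ε}_𝔪` (Wake–Wang-Erickson 2021,
special sign patterns only; their Thm. 1.4.6 exhibits non-Gorenstein components, where the seat's data
say the reduction is LINEAR in the Kummer class rather than constant — (C-Θ), HOME/lam-a-g6/
lam-a-MEMO-6.md §5, HOME/lam-a-g7/lam-a-MEMO-7.md). The hypotheses are displayed so that a future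
typed fact can be consumed verbatim; per pair they are no cheaper than a certificate.

References: [PollackWake2025] §1.4, Thm. 1.2; [WakeWangErickson2021] Thm. 1.4.1, §1.5.2;
[GreenbergVatsal2000] §1 (9)–(10); HOME/lam-a-g7/lam-a-MEMO-7.md.
-/

set_option linter.dupNamespace false
set_option autoImplicit false

noncomputable section

open scoped Classical MatrixGroups ModularForm

open PowerSeries CongruenceSubgroup WeierstrassCurve
  Literature.NumberTheory.EllipticCurves
  Literature.NumberTheory.EllipticCurves.ModularForms
  Literature.NumberTheory.EllipticCurves.GreenbergVatsal2000
  Summit.BirchSwinnertonDyer.Rank1Residual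
  Summit.BirchSwinnertonDyer.Rank1Residual.X1.MuLambda
  Summit.BirchSwinnertonDyer.Rank1Residual.Iwasawa
  Summit.BirchSwinnertonDyer.BirchSwinnertonDyer.Theorems
  Summit.BirchSwinnertonDyer.BirchSwinnertonDyer.Theorems.EisensteinPrimesAnalyticLambdaCongruenceTransfer

namespace Summit.BirchSwinnertonDyer.BirchSwinnertonDyer.Theorems.EisensteinPrimesAnalyticLambdaCommonSource

variable {p : ℕ} [hp : Fact p.Prime]

/-! ## §1. `Λ`-algebra: a common source gives the congruence mod `p` to every order -/

section Algebra

variable {R : Type*} [CommRing R]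

/-- A `p`-adic integer that is a unit has non-zero reduction mod `p` (`ker toZMod = 𝔪_{ℤ_p}`).
[folklore] -/
theorem toZMod_ne_zero_of_isUnit {c : ℤ_[p]} (hc : IsUnit c) :
    PadicInt.toZMod (p := p) c ≠ 0 := by
  intro h0
  have hmem : c ∈ RingHom.ker (PadicInt.toZMod (p := p)) := (RingHom.mem_ker).mpr h0
  rw [PadicInt.ker_toZMod, IsLocalRing.mem_maximalIdeal, mem_nonunits_iff] at hmem
  exact hmem hc

/-- The reduction mod `p` of `C(c)·θ(ℒ)`, coefficientwise: `c̄ · θ̄([T^j]ℒ)`. [folklore] -/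
theorem coeff_map_toZMod_C_mul_map (θ : R →+* ℤ_[p]) (ℒ : PowerSeries R) (c : ℤ_[p]) (j : ℕ) :
    PowerSeries.coeff j (PowerSeries.map (PadicInt.toZMod (p := p))
        (PowerSeries.C c * PowerSeries.map θ ℒ)) =
      PadicInt.toZMod (p := p) c *
        ((PadicInt.toZMod (p := p)).comp θ) (PowerSeries.coeff j ℒ) := by
  rw [PowerSeries.coeff_map, PowerSeries.coeff_C_mul, map_mul, PowerSeries.coeff_map,
    RingHom.comp_apply]

/-- **Common source ⟹ congruence mod `p` to every order.** If `x₁ = C(c₁)·θ₁(ℒ)` and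
`x₂ = C(c₂)·θ₂(ℒ)` in `Λ = ℤ_p⟦T⟧` for ONE `ℒ ∈ R⟦T⟧`, ring maps `θ₁, θ₂ : R → ℤ_p` with the same
reduction `R → 𝔽_p`, and units `c₁, c₂`, then `x̄₁ = u·x̄₂` coefficientwise with
`u = c̄₁·c̄₂⁻¹ ≠ 0` — the displayed hypothesis of the g5 twin socket, for every truncation order.
(The shape of Pollack–Wake's cuspidal normalisation: all members of a Gorenstein component are
specialisations of one `L^{+,cusp}(𝔪)`.) [cite: PollackWake2025, §1.4] [folklore] -/
theorem coeff_map_toZMod_eq_mul_of_commonSource (θ₁ θ₂ : R →+* ℤ_[p])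
    (hθ : (PadicInt.toZMod (p := p)).comp θ₁ = (PadicInt.toZMod (p := p)).comp θ₂)
    (ℒ : PowerSeries R) {c₁ c₂ : ℤ_[p]} (hc₁ : IsUnit c₁) (hc₂ : IsUnit c₂)
    {x₁ x₂ : IwasawaAlgebra p} (hx₁ : x₁ = PowerSeries.C c₁ * PowerSeries.map θ₁ ℒ)
    (hx₂ : x₂ = PowerSeries.C c₂ * PowerSeries.map θ₂ ℒ) :
    ∃ u : ZMod p, u ≠ 0 ∧ ∀ j : ℕ,
      PowerSeries.coeff j (PowerSeries.map (PadicInt.toZMod (p := p)) x₁) =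
        u * PowerSeries.coeff j (PowerSeries.map (PadicInt.toZMod (p := p)) x₂) := by
  have h₁ := toZMod_ne_zero_of_isUnit hc₁
  have h₂ := toZMod_ne_zero_of_isUnit hc₂
  refine ⟨PadicInt.toZMod (p := p) c₁ * (PadicInt.toZMod (p := p) c₂)⁻¹,
    mul_ne_zero h₁ (inv_ne_zero h₂), fun j => ?_⟩
  rw [hx₁, hx₂, coeff_map_toZMod_C_mul_map, coeff_map_toZMod_C_mul_map, hθ]
  field_simp

/-- **Common source with multipliers ⟹ `μ(b₁) = 0` and `λ(b₁) + d₁ = λ(b₂) + d₂`.** If the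
Σ₀-depleted models `b₁P₁`, `b₂P₂` have a common source as above, `P₂` has unit content, the
reductions of `P₁, P₂` have `T`-orders `d₁, d₂`, and `b₂` has unit content, then `b₁` has unit content
and `λ(b₁) + d₁ = λ(b₂) + d₂` (the g5 socket `hasUnitContent_and_lam_add_eq_of_truncCongr_mul` at
truncation order `λ(b₂) + d₂ + 1`). [cite: GreenbergVatsal2000, §1 (9)–(10)] [cite: PollackWake2025, §1.4] -/
theorem hasUnitContent_and_lam_add_eq_of_commonSource (θ₁ θ₂ : R →+* ℤ_[p])
    (hθ : (PadicInt.toZMod (p := p)).comp θ₁ = (PadicInt.toZMod (p := p)).comp θ₂)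
    (ℒ : PowerSeries R) {c₁ c₂ : ℤ_[p]} (hc₁ : IsUnit c₁) (hc₂ : IsUnit c₂)
    {b₁ b₂ P₁ P₂ : IwasawaAlgebra p} (hx₁ : b₁ * P₁ = PowerSeries.C c₁ * PowerSeries.map θ₁ ℒ)
    (hx₂ : b₂ * P₂ = PowerSeries.C c₂ * PowerSeries.map θ₂ ℒ) {d₁ d₂ : ℕ}
    (hd₁ : (PowerSeries.map (PadicInt.toZMod (p := p)) P₁).order = d₁) (hP₂ : HasUnitContent P₂)
    (hd₂ : (PowerSeries.map (PadicInt.toZMod (p := p)) P₂).order = d₂) (hb₂ : HasUnitContent b₂) :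
    HasUnitContent b₁ ∧ lam b₁ + d₁ = lam b₂ + d₂ := by
  obtain ⟨u, hu, hcong⟩ := coeff_map_toZMod_eq_mul_of_commonSource θ₁ θ₂ hθ ℒ hc₁ hc₂ hx₁ hx₂
  exact hasUnitContent_and_lam_add_eq_of_truncCongr_mul hd₁ hP₂ hd₂ hu (K := lam b₂ + d₂ + 1)
    (fun j _ => hcong j) hb₂ (Nat.lt_succ_self _)

end Algebra

/-! ## §2. X2 ← X2: both analytic inputs of stubs 3 + 4 at `W` from a twin and a common source -/

section X2X2

variable {W : WeierstrassCurve ℚ} [W.IsElliptic] [W.IsGloballyMinimal]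
  {N : ℕ} [NeZero N] {f : CuspForm (Gamma0 N) 2} {ϖ : ℚ} {L : PowerSeries ℚ_[p]}
  {W' : WeierstrassCurve ℚ} [W'.IsElliptic] [W'.IsGloballyMinimal]
  {N' : ℕ} [NeZero N'] {f' : CuspForm (Gamma0 N') 2} {ϖ' : ℚ} {L' : PowerSeries ℚ_[p]}
  {R : Type*} [CommRing R]

/-- **X2 ← X2 from a common source.** Data `(f, ϖ, L, G)` at `(W, p)` (odd multiplicative `p`) and
`(f′, ϖ′, L′, G′)` at the twin `(W′, p)` as in the g5 socket; the twin's certificate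
`X2.AnalyticMuLE W′ p 0 ∧ X2.AnalyticLambdaEq W′ p n′`; multipliers `P, P′` of `T`-orders `d, d′`,
`P′` of unit content; and, INSTEAD of a displayed truncated congruence, a common source: a
commutative ring `R`, ring maps `θ, θ′ : R → ℤ_p` with the same reduction mod `p`, one
`ℒ ∈ R⟦T⟧` and units `c, c′ ∈ ℤ_p` with `G·P = C(c)·θ(ℒ)`, `G′·P′ = C(c′)·θ′(ℒ)`; and the count
`n + d = n′ + d′`. Conclusion: `X2.AnalyticMuLE W p 0 ∧ X2.AnalyticLambdaEq W p n`.
[cite: PollackWake2025, §1.4] [cite: GreenbergVatsal2000, §1 (9)–(10), Thm. (1.4)] -/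
theorem X2.analyticMuLE_zero_and_analyticLambdaEq_of_commonSource (hf : IsNewformOf W f)
    (hϖ : (ϖ : ℝ) * W.realPeriodRat = plusPeriod f)
    (hLs : W.HasSplitMultiplicativeReductionAtPrime p → IsSplitMultPAdicLFunctionOf f p L)
    (hLn : ¬ W.HasSplitMultiplicativeReductionAtPrime p → IsMultPAdicLFunctionOf f p (-1) L)
    {G : IwasawaAlgebra p} (hG : iwasawaToPowerSeries p G = PowerSeries.C ((ϖ : ℚ) : ℚ_[p]) * L)
    (hf' : IsNewformOf W' f') (hϖ' : (ϖ' : ℝ) * W'.realPeriodRat = plusPeriod f')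
    (hLs' : W'.HasSplitMultiplicativeReductionAtPrime p → IsSplitMultPAdicLFunctionOf f' p L')
    (hLn' : ¬ W'.HasSplitMultiplicativeReductionAtPrime p → IsMultPAdicLFunctionOf f' p (-1) L')
    {G' : IwasawaAlgebra p}
    (hG' : iwasawaToPowerSeries p G' = PowerSeries.C ((ϖ' : ℚ) : ℚ_[p]) * L')
    (hμ' : X2.AnalyticMuLE W' p 0) {n' : ℕ} (hlam' : X2.AnalyticLambdaEq W' p n')
    {P P' : IwasawaAlgebra p} {d d' : ℕ}
    (hd : (PowerSeries.map (PadicInt.toZMod (p := p)) P).order = d) (hP' : HasUnitContent P')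
    (hd' : (PowerSeries.map (PadicInt.toZMod (p := p)) P').order = d')
    (θ θ' : R →+* ℤ_[p])
    (hθ : (PadicInt.toZMod (p := p)).comp θ = (PadicInt.toZMod (p := p)).comp θ')
    (ℒ : PowerSeries R) {c c' : ℤ_[p]} (hc : IsUnit c) (hc' : IsUnit c')
    (hx : G * P = PowerSeries.C c * PowerSeries.map θ ℒ)
    (hx' : G' * P' = PowerSeries.C c' * PowerSeries.map θ' ℒ)
    {n : ℕ} (hn : n + d = n' + d') :
    X2.AnalyticMuLE W p 0 ∧ X2.AnalyticLambdaEq W p n := by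
  obtain ⟨u, hu, hcong⟩ := coeff_map_toZMod_eq_mul_of_commonSource θ θ' hθ ℒ hc hc' hx hx'
  exact EisensteinPrimesAnalyticLambdaCongruenceTransfer.X2.analyticMuLE_zero_and_analyticLambdaEq_of_truncCongr
    hf hϖ hLs hLn hG hf' hϖ' hLs' hLn' hG' hμ' hlam' hd hP' hd' hu (K := n' + d' + 1)
    (fun j _ => hcong j) (Nat.lt_succ_self _) hn

end X2X2

end Summit.BirchSwinnertonDyer.BirchSwinnertonDyer.Theorems.EisensteinPrimesAnalyticLambdaCommonSource

end
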